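import Literature.Analysis.FluidPDE.PassiveScalarDiagForced
import Literature.Analysis.FluidPDE.PassiveScalarSteadyTest
import HarnessLib

/-!
# The solution class of weak passive scalars with constant diagonal diffusion and a source

Analysis/FluidPDE proof-support file (everything proved; no definitions, no named facts). The
class lemmas of `PassiveScalarProofs` / `PassiveScalarForcedClass` — joint measurability of `θ`,
`u`, `s` on `(0,T) × T^d`, the `L^∞_t L²_x` bound in `eLpNorm` form, `θ(t) ∈ L²` for a.e. `t`,
`θ, s, ‖u‖θ ∈ L¹_{t,x}`, integrability of `θ c`, `s c`, `θ⟪u, G⟫` for continuous steady `c`, `G`,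
of the steady flux `θ (⟪u, ∇g⟫ + κ ∑ᵢ aᵢ ∂ᵢ∂ᵢ g)`, of the weak integrand
`θ (∂ₜψ + u·∇ψ + κ ∑ᵢ aᵢ ∂ᵢ∂ᵢψ)` and of the source term `s ψ` for a space–time test function `ψ`,
and the weak identity in product-measure form — for the notion
`Torus.IsWeakScalarTransportDiagForcedOn T a κ u s θ₀ θ` of `PassiveScalarDiagForced`
(`∂ₜθ + u·∇θ = κ ∑ᵢ aᵢ ∂ᵢ∂ᵢθ + s` on `T^d × [0,T)`; DiPerna–Lions 1989, §II.1 (12)–(14) with a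
right-hand side, DEIJ 2022 (1.1), in the diagonal rendering of Hess-Childs–Rowan's flat torus
`[0,√2]×[0,1]`). The coefficient vector `a : d → ℝ` is arbitrary here (no sign condition is used
by this bookkeeping).

This is the first file of the "diag parabolic layer" (cell `ad-ideate`, ROUND-11 §2.3, T1–T4); the
bookkeeping of horizons / drifts / sources, the steady-test identity, the `L²` trace and the restart
property are in `PassiveScalarDiagForcedCongr`, `PassiveScalarDiagForcedSteadyTest`,
`PassiveScalarDiagForcedTrace`, `PassiveScalarDiagForcedRestart`.

## Mathlib / tree search

Tree (reused verbatim, isotropic twins): `IsWeakScalarTransportForcedOn.integrable_weakIntegrand`,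
`….integral_prod_weak_eq` (`PassiveScalarForcedClass`), `Torus.volume_restrict_prod_eq`,
`Torus.exists_bound_of_continuous_uncurry` (`PassiveScalarProofs`),
`IsSmoothSpaceTimeOn.partialDeriv` (`TorusSpaceTime`); `lean search DiagForcedOn`: only the
definition file `PassiveScalarDiagForced`.

## References

* R. J. DiPerna, P.-L. Lions, Invent. Math. 98 (1989), §II.1, (12)–(14). [`DiPernaLions1989`]
* T. D. Drivas, T. M. Elgindi, G. Iyer, I.-J. Jeong, ARMA 243 (2022), (1.1). [`DEIJ2022`]
-/

noncomputable section

open _root_.MeasureTheory _root_.Set _root_.Filter _root_.Function _root_.TopologicalSpace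
open scoped ENNReal NNReal InnerProductSpace ContDiff

namespace Literature.Analysis.FluidPDE

namespace Torus

variable {d : Type*} [Fintype d] [DecidableEq d]

/-! ## Second spatial derivatives of space–time test fields -/

/-- Second spatial partial derivatives `(t, x) ↦ ∂ᵢ∂ⱼ(ψ t)(x)` of a space–time test field are
jointly continuous. [folklore] -/
private theorem continuous_uncurry_partialDeriv_partialDeriv_test
    {T : ℝ} {ψ : ℝ → UnitAddTorus d → ℝ} (hψ : FunctionSpaces.Torus.IsSpaceTimeTest T ψ) (i j : d) :
    Continuous (uncurry fun t x =>
      FunctionSpaces.Torus.partialDeriv i (FunctionSpaces.Torus.partialDeriv j (ψ t)) x) := by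
  have h := (((hψ.isSmoothSpaceTimeOn univ).partialDeriv uniqueDiffOn_univ j).partialDeriv
    uniqueDiffOn_univ i).continuousOn_stLift
  rw [univ_prod_univ, continuousOn_univ] at h
  exact FunctionSpaces.Torus.continuous_uncurry_of_continuous_stLift h

/-- The diagonal operator `(t, x) ↦ ∑ᵢ aᵢ ∂ᵢ∂ᵢ(ψ t)(x)` of a space–time test field is jointly
continuous. [folklore] -/
private theorem continuous_uncurry_diagOp_test
    {T : ℝ} {ψ : ℝ → UnitAddTorus d → ℝ} (hψ : FunctionSpaces.Torus.IsSpaceTimeTest T ψ) (a : d → ℝ) :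
    Continuous (uncurry fun t x =>
      ∑ i, a i * FunctionSpaces.Torus.partialDeriv i (FunctionSpaces.Torus.partialDeriv i (ψ t)) x) := by
  have e : (uncurry fun t x =>
      ∑ i, a i * FunctionSpaces.Torus.partialDeriv i (FunctionSpaces.Torus.partialDeriv i (ψ t)) x) =
      fun p : ℝ × UnitAddTorus d => ∑ i, a i * (uncurry fun t x =>
        FunctionSpaces.Torus.partialDeriv i (FunctionSpaces.Torus.partialDeriv i (ψ t)) x) p := by
    funext p; rfl
  rw [e]
  exact continuous_finsetSum _ fun i _ =>
    continuous_const.mul (continuous_uncurry_partialDeriv_partialDeriv_test hψ i i)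

/-- The diagonal operator `x ↦ ∑ᵢ aᵢ ∂ᵢ∂ᵢ g(x)` of a smooth steady field is continuous. [folklore] -/
private theorem continuous_diagOp {g : UnitAddTorus d → ℝ} (hg : FunctionSpaces.Torus.IsSmooth g) (a : d → ℝ) :
    Continuous fun x =>
      ∑ i, a i * FunctionSpaces.Torus.partialDeriv i (FunctionSpaces.Torus.partialDeriv i g) x :=
  continuous_finsetSum _ fun i _ =>
    continuous_const.mul ((hg.partialDeriv i).partialDeriv i).continuous

namespace IsWeakScalarTransportDiagForcedOn

variable {T κ : ℝ} {a : d → ℝ} {u : ℝ → UnitAddTorus d → EuclideanSpace ℝ d}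
  {s : ℝ → UnitAddTorus d → ℝ} {θ₀ : UnitAddTorus d → ℝ} {θ : ℝ → UnitAddTorus d → ℝ}
  {ψ : ℝ → UnitAddTorus d → ℝ}

/-! ## Measurability and the `L^∞_t L²_x` bound -/

/-- Joint measurability of `θ` on `(0,T) × T^d`. [cite: DiPernaLions1989, §II.1 (12)–(14)] -/
theorem aestronglyMeasurable_uncurry (h : IsWeakScalarTransportDiagForcedOn T a κ u s θ₀ θ) :
    AEStronglyMeasurable (uncurry θ) (((volume : Measure ℝ).restrict (Ioo 0 T)).prod volume) := by
  rw [← volume_restrict_prod_eq]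
  exact FunctionSpaces.Torus.aestronglyMeasurable_uncurry_of_stLift_restrict h.aestronglyMeasurable

/-- Joint measurability of `u` on `(0,T) × T^d`. [cite: DiPernaLions1989, §II.1 (12)–(14)] -/
theorem aestronglyMeasurable_uncurry_velocity (h : IsWeakScalarTransportDiagForcedOn T a κ u s θ₀ θ) :
    AEStronglyMeasurable (uncurry u) (((volume : Measure ℝ).restrict (Ioo 0 T)).prod volume) := by
  rw [← volume_restrict_prod_eq]
  exact FunctionSpaces.Torus.aestronglyMeasurable_uncurry_of_stLift_restrict
    h.aestronglyMeasurable_velocity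

/-- Joint measurability of the source `s` on `(0,T) × T^d`. [cite: DiPernaLions1989, §II.1 (12)–(14)] -/
theorem aestronglyMeasurable_uncurry_source (h : IsWeakScalarTransportDiagForcedOn T a κ u s θ₀ θ) :
    AEStronglyMeasurable (uncurry s) (((volume : Measure ℝ).restrict (Ioo 0 T)).prod volume) := by
  rw [← volume_restrict_prod_eq]
  exact FunctionSpaces.Torus.aestronglyMeasurable_uncurry_of_stLift_restrict
    h.aestronglyMeasurable_source

/-- The time slices `θ t` are a.e.-strongly measurable for a.e. `t ∈ (0,T)`. [cite: DiPernaLions1989, §II.1 (12)–(14)] -/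
theorem ae_aestronglyMeasurable_slice (h : IsWeakScalarTransportDiagForcedOn T a κ u s θ₀ θ) :
    ∀ᵐ t ∂(volume.restrict (Ioo 0 T)), AEStronglyMeasurable (θ t) volume :=
  h.aestronglyMeasurable_uncurry.prodMk_left

/-- The `L^∞_t L²_x` bound in `eLpNorm` form: `‖θ(t)‖_{L²} ≤ C` for a.e. `t ∈ (0,T)`. [cite: DiPernaLions1989, §II.1 (12)–(14)] -/
theorem exists_eLpNorm_le (h : IsWeakScalarTransportDiagForcedOn T a κ u s θ₀ θ) :
    ∃ C : ℝ≥0, ∀ᵐ t ∂(volume.restrict (Ioo 0 T)), eLpNorm (θ t) 2 volume ≤ C := by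
  obtain ⟨C, hC⟩ := h.ae_lintegral_sq_le
  refine ⟨NNReal.sqrt C, ?_⟩
  filter_upwards [hC] with t ht
  rw [eLpNorm_eq_lintegral_rpow_enorm_toReal two_ne_zero ENNReal.ofNat_ne_top, ENNReal.toReal_ofNat]
  have h2 : ∫⁻ x, ‖θ t x‖ₑ ^ (2 : ℝ) = ∫⁻ x, ‖θ t x‖ₑ ^ 2 := by
    refine lintegral_congr fun x => ?_
    rw [← ENNReal.rpow_two]
  rw [h2]
  calc (∫⁻ x, ‖θ t x‖ₑ ^ 2) ^ (1 / (2 : ℝ)) ≤ (C : ℝ≥0∞) ^ (1 / (2 : ℝ)) := by gcongr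
    _ = NNReal.sqrt C := by
        rw [← ENNReal.coe_rpow_of_nonneg _ (by norm_num), ← NNReal.sqrt_eq_rpow]

/-- For a.e. `t ∈ (0,T)`, `θ t ∈ L²(T^d)`. [cite: DiPernaLions1989, §II.1 (12)–(14)] -/
theorem ae_memLp_two (h : IsWeakScalarTransportDiagForcedOn T a κ u s θ₀ θ) :
    ∀ᵐ t ∂(volume.restrict (Ioo 0 T)), MemLp (θ t) 2 volume := by
  obtain ⟨C, hC⟩ := h.exists_eLpNorm_le
  filter_upwards [hC, h.ae_aestronglyMeasurable_slice] with t ht hm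
  exact ⟨hm, ht.trans_lt ENNReal.coe_lt_top⟩

/-! ## Integrability on `(0,T) × T^d` -/

/-- `θ ∈ L¹((0,T) × T^d)`. [cite: DiPernaLions1989, §II.1 (12)–(14)] -/
theorem integrable_uncurry (h : IsWeakScalarTransportDiagForcedOn T a κ u s θ₀ θ) :
    Integrable (uncurry θ) (((volume : Measure ℝ).restrict (Ioo 0 T)).prod volume) := by
  obtain ⟨C, hC⟩ := h.exists_eLpNorm_le
  refine ⟨h.aestronglyMeasurable_uncurry, ?_⟩
  rw [hasFiniteIntegral_iff_enorm, lintegral_prod _ h.aestronglyMeasurable_uncurry.enorm]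
  calc ∫⁻ t in Ioo 0 T, ∫⁻ x, ‖uncurry θ (t, x)‖ₑ
      ≤ ∫⁻ _ in Ioo 0 T, (C : ℝ≥0∞) := by
        refine lintegral_mono_ae ?_
        filter_upwards [hC, h.ae_aestronglyMeasurable_slice] with t ht hm
        calc ∫⁻ x, ‖uncurry θ (t, x)‖ₑ = eLpNorm (θ t) 1 volume := by
              rw [eLpNorm_one_eq_lintegral_enorm]; rfl
          _ ≤ eLpNorm (θ t) 2 volume := eLpNorm_le_eLpNorm_of_exponent_le (by norm_num) hm
          _ ≤ C := ht
    _ < ⊤ := by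
        rw [setLIntegral_const]
        exact ENNReal.mul_lt_top ENNReal.coe_lt_top measure_Ioo_lt_top

/-- `s ∈ L¹((0,T) × T^d)` as an `Integrable` statement. [cite: DiPernaLions1989, §II.1 (12)–(14)] -/
theorem integrable_uncurry_source (h : IsWeakScalarTransportDiagForcedOn T a κ u s θ₀ θ) :
    Integrable (uncurry s) (((volume : Measure ℝ).restrict (Ioo 0 T)).prod volume) := by
  refine ⟨h.aestronglyMeasurable_uncurry_source, ?_⟩
  rw [hasFiniteIntegral_iff_enorm, lintegral_prod _ h.aestronglyMeasurable_uncurry_source.enorm]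
  exact h.lintegral_source_lt_top

/-- `‖u‖ θ ∈ L¹((0,T) × T^d)`. [cite: DiPernaLions1989, §II.1 (12)–(14)] -/
theorem integrable_norm_velocity_mul (h : IsWeakScalarTransportDiagForcedOn T a κ u s θ₀ θ) :
    Integrable (fun p : ℝ × UnitAddTorus d => ‖u p.1 p.2‖ * θ p.1 p.2)
      (((volume : Measure ℝ).restrict (Ioo 0 T)).prod volume) := by
  have hm : AEStronglyMeasurable (fun p : ℝ × UnitAddTorus d => ‖u p.1 p.2‖ * θ p.1 p.2)
      (((volume : Measure ℝ).restrict (Ioo 0 T)).prod volume) :=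
    h.aestronglyMeasurable_uncurry_velocity.norm.mul h.aestronglyMeasurable_uncurry
  refine ⟨hm, ?_⟩
  rw [hasFiniteIntegral_iff_enorm, lintegral_prod _ hm.enorm]
  have h' := h.lintegral_mul_lt_top
  simp only [enorm_mul, enorm_norm] at h' ⊢
  exact h'

/-- Slice integrability for a.e. `t ∈ (0,T)`: `θ t ∈ L¹`, `u t` a.e.-strongly measurable,
`‖u t‖ θ t ∈ L¹`, `s t ∈ L¹`. [cite: DiPernaLions1989, §II.1 (12)–(14)] -/
theorem ae_slice_integrable (h : IsWeakScalarTransportDiagForcedOn T a κ u s θ₀ θ) :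
    ∀ᵐ t ∂(volume.restrict (Ioo 0 T)), Integrable (θ t) volume ∧ AEStronglyMeasurable (u t) volume ∧
      Integrable (fun x => ‖u t x‖ * θ t x) volume ∧ Integrable (s t) volume := by
  filter_upwards [h.integrable_uncurry.prod_right_ae, h.aestronglyMeasurable_uncurry_velocity.prodMk_left,
    h.integrable_norm_velocity_mul.prod_right_ae, h.integrable_uncurry_source.prod_right_ae]
    with t h₁ h₂ h₃ h₄
  exact ⟨h₁, h₂, h₃, h₄⟩

/-- Integrability on `(0,T) × T^d` of `θ(t,x) c(x)` for continuous `c`. [cite: DiPernaLions1989, §II.1 (12)–(14)] -/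
theorem integrable_mul_continuous (h : IsWeakScalarTransportDiagForcedOn T a κ u s θ₀ θ)
    {c : UnitAddTorus d → ℝ} (hc : Continuous c) :
    Integrable (fun p : ℝ × UnitAddTorus d => θ p.1 p.2 * c p.2)
      (((volume : Measure ℝ).restrict (Ioo 0 T)).prod volume) := by
  obtain ⟨C, hC⟩ := FunctionSpaces.Torus.exists_forall_norm_le_of_continuous hc
  exact h.integrable_uncurry.mul_bdd (hc.comp continuous_snd).aestronglyMeasurable
    (Eventually.of_forall fun p => hC p.2)

/-- Integrability on `(0,T) × T^d` of `s(t,x) c(x)` for continuous `c`. [cite: DiPernaLions1989, §II.1 (12)–(14)] -/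
theorem integrable_source_mul_continuous (h : IsWeakScalarTransportDiagForcedOn T a κ u s θ₀ θ)
    {c : UnitAddTorus d → ℝ} (hc : Continuous c) :
    Integrable (fun p : ℝ × UnitAddTorus d => s p.1 p.2 * c p.2)
      (((volume : Measure ℝ).restrict (Ioo 0 T)).prod volume) := by
  obtain ⟨C, hC⟩ := FunctionSpaces.Torus.exists_forall_norm_le_of_continuous hc
  exact h.integrable_uncurry_source.mul_bdd (hc.comp continuous_snd).aestronglyMeasurable
    (Eventually.of_forall fun p => hC p.2)

/-- Integrability on `(0,T) × T^d` of `θ ⟪u, G⟫` for continuous `G`. [cite: DiPernaLions1989, §II.1 (12)–(14)] -/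
theorem integrable_mul_inner_continuous (h : IsWeakScalarTransportDiagForcedOn T a κ u s θ₀ θ)
    {G : UnitAddTorus d → EuclideanSpace ℝ d} (hG : Continuous G) :
    Integrable (fun p : ℝ × UnitAddTorus d => θ p.1 p.2 * ⟪u p.1 p.2, G p.2⟫_ℝ)
      (((volume : Measure ℝ).restrict (Ioo 0 T)).prod volume) := by
  obtain ⟨C, hC⟩ := FunctionSpaces.Torus.exists_forall_norm_le_of_continuous hG
  have hm : AEStronglyMeasurable (fun p : ℝ × UnitAddTorus d => θ p.1 p.2 * ⟪u p.1 p.2, G p.2⟫_ℝ)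
      (((volume : Measure ℝ).restrict (Ioo 0 T)).prod volume) :=
    h.aestronglyMeasurable_uncurry.mul
      (h.aestronglyMeasurable_uncurry_velocity.inner (hG.comp continuous_snd).aestronglyMeasurable)
  refine (h.integrable_norm_velocity_mul.norm.const_mul C).mono' hm (Eventually.of_forall fun p => ?_)
  rw [norm_mul, Real.norm_eq_abs, Real.norm_eq_abs, norm_mul, norm_norm, Real.norm_eq_abs]
  calc |θ p.1 p.2| * |⟪u p.1 p.2, G p.2⟫_ℝ| ≤ |θ p.1 p.2| * (‖u p.1 p.2‖ * C) :=
        mul_le_mul_of_nonneg_left ((abs_real_inner_le_norm _ _).trans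
          (mul_le_mul_of_nonneg_left (hC p.2) (norm_nonneg _))) (abs_nonneg _)
    _ = C * (‖u p.1 p.2‖ * |θ p.1 p.2|) := by ring

/-- Integrability on `(0,T) × T^d` of the steady flux `θ (⟪u, ∇g⟫ + κ ∑ᵢ aᵢ ∂ᵢ∂ᵢ g)` for a
smooth steady `g`. [cite: DiPernaLions1989, §II.1 (12)–(14)] -/
theorem integrable_mul_steadyFlux (h : IsWeakScalarTransportDiagForcedOn T a κ u s θ₀ θ)
    {g : UnitAddTorus d → ℝ} (hg : FunctionSpaces.Torus.IsSmooth g) :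
    Integrable (fun p : ℝ × UnitAddTorus d => θ p.1 p.2 *
      (⟪u p.1 p.2, FunctionSpaces.Torus.gradient g p.2⟫_ℝ +
        κ * ∑ i, a i * FunctionSpaces.Torus.partialDeriv i (FunctionSpaces.Torus.partialDeriv i g) p.2))
      (((volume : Measure ℝ).restrict (Ioo 0 T)).prod volume) := by
  have e : (fun p : ℝ × UnitAddTorus d => θ p.1 p.2 *
      (⟪u p.1 p.2, FunctionSpaces.Torus.gradient g p.2⟫_ℝ +
        κ * ∑ i, a i * FunctionSpaces.Torus.partialDeriv i (FunctionSpaces.Torus.partialDeriv i g) p.2)) =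
      fun p => θ p.1 p.2 * ⟪u p.1 p.2, FunctionSpaces.Torus.gradient g p.2⟫_ℝ +
        θ p.1 p.2 * (κ * ∑ i, a i *
          FunctionSpaces.Torus.partialDeriv i (FunctionSpaces.Torus.partialDeriv i g) p.2) := by
    funext p; ring
  rw [e]
  exact (h.integrable_mul_inner_continuous hg.gradient.continuous).add
    (h.integrable_mul_continuous (continuous_const.mul (continuous_diagOp hg a)))

/-! ## Pairings with jointly continuous space–time fields -/

/-- Integrability on `(0,T) × T^d` of `θ(t,x) φ(t,x)` for a jointly continuous `φ` (bounded on
`[0,T] × T^d`). [cite: DiPernaLions1989, §II.1 (12)–(14)] -/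
theorem integrable_mul_of_continuous (h : IsWeakScalarTransportDiagForcedOn T a κ u s θ₀ θ)
    {φ : ℝ → UnitAddTorus d → ℝ} (hφ : Continuous (uncurry φ)) :
    Integrable (fun p : ℝ × UnitAddTorus d => θ p.1 p.2 * φ p.1 p.2)
      (((volume : Measure ℝ).restrict (Ioo 0 T)).prod volume) := by
  obtain ⟨C₀, hC₀⟩ := exists_bound_of_continuous_uncurry hφ 0 T
  refine Integrable.mono' (g := fun p : ℝ × UnitAddTorus d => C₀ * ‖uncurry θ p‖)
    (h.integrable_uncurry.norm.const_mul C₀)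
    (h.aestronglyMeasurable_uncurry.mul hφ.aestronglyMeasurable) ?_
  filter_upwards [IsWeakScalarTransportForcedOn.ae_fst_mem_Ioo (d := d) T] with p hp
  rw [norm_mul, mul_comm]
  exact mul_le_mul_of_nonneg_right (hC₀ p.1 (Ioo_subset_Icc_self hp) p.2) (norm_nonneg _)

/-- Integrability on `(0,T) × T^d` of `s(t,x) φ(t,x)` for a jointly continuous `φ`. [cite: DiPernaLions1989, §II.1 (12)–(14)] -/
theorem integrable_source_mul_of_continuous (h : IsWeakScalarTransportDiagForcedOn T a κ u s θ₀ θ)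
    {φ : ℝ → UnitAddTorus d → ℝ} (hφ : Continuous (uncurry φ)) :
    Integrable (fun p : ℝ × UnitAddTorus d => s p.1 p.2 * φ p.1 p.2)
      (((volume : Measure ℝ).restrict (Ioo 0 T)).prod volume) := by
  obtain ⟨C₀, hC₀⟩ := exists_bound_of_continuous_uncurry hφ 0 T
  refine Integrable.mono' (g := fun p : ℝ × UnitAddTorus d => C₀ * ‖uncurry s p‖)
    (h.integrable_uncurry_source.norm.const_mul C₀)
    (h.aestronglyMeasurable_uncurry_source.mul hφ.aestronglyMeasurable) ?_
  filter_upwards [IsWeakScalarTransportForcedOn.ae_fst_mem_Ioo (d := d) T] with p hp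
  rw [norm_mul, mul_comm]
  exact mul_le_mul_of_nonneg_right (hC₀ p.1 (Ioo_subset_Icc_self hp) p.2) (norm_nonneg _)

/-- **Integrability of the weak integrand** `θ (Φ₁ + ⟪u, Φ₂⟫ + κ Φ₃)` on `(0,T) × T^d` for
jointly continuous fields `Φ₁` (scalar), `Φ₂` (vector), `Φ₃` (scalar) — the shape
`∂ₜφ`, `∇φ`, `∑ᵢ aᵢ ∂ᵢ∂ᵢφ` of a smooth space–time field `φ` (`θ, ‖u‖θ ∈ L¹_{t,x}` and the three
fields are bounded on `[0,T] × T^d`). [cite: DiPernaLions1989, §II.1 (12)–(14)] -/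
theorem integrable_weakIntegrand_of_continuous (h : IsWeakScalarTransportDiagForcedOn T a κ u s θ₀ θ)
    {Φ₁ : ℝ → UnitAddTorus d → ℝ} {Φ₂ : ℝ → UnitAddTorus d → EuclideanSpace ℝ d}
    {Φ₃ : ℝ → UnitAddTorus d → ℝ} (hΦ₁ : Continuous (uncurry Φ₁)) (hΦ₂ : Continuous (uncurry Φ₂))
    (hΦ₃ : Continuous (uncurry Φ₃)) :
    Integrable (fun p : ℝ × UnitAddTorus d => θ p.1 p.2 *
      (Φ₁ p.1 p.2 + ⟪u p.1 p.2, Φ₂ p.1 p.2⟫_ℝ + κ * Φ₃ p.1 p.2))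
      (((volume : Measure ℝ).restrict (Ioo 0 T)).prod volume) := by
  obtain ⟨C₁, hC₁⟩ := exists_bound_of_continuous_uncurry hΦ₁ 0 T
  obtain ⟨C₂, hC₂⟩ := exists_bound_of_continuous_uncurry hΦ₂ 0 T
  obtain ⟨C₃, hC₃⟩ := exists_bound_of_continuous_uncurry hΦ₃ 0 T
  have hmθ := h.aestronglyMeasurable_uncurry
  have hmu := h.aestronglyMeasurable_uncurry_velocity
  have hm : AEStronglyMeasurable (fun p : ℝ × UnitAddTorus d => θ p.1 p.2 *
      (Φ₁ p.1 p.2 + ⟪u p.1 p.2, Φ₂ p.1 p.2⟫_ℝ + κ * Φ₃ p.1 p.2))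
      (((volume : Measure ℝ).restrict (Ioo 0 T)).prod volume) := by
    refine hmθ.mul ((?_ : AEStronglyMeasurable _ _).add ?_ |>.add ?_)
    · exact hΦ₁.aestronglyMeasurable
    · exact hmu.inner hΦ₂.aestronglyMeasurable
    · exact (continuous_const.mul hΦ₃).aestronglyMeasurable
  refine Integrable.mono' (g := fun p : ℝ × UnitAddTorus d =>
      C₁ * ‖uncurry θ p‖ + C₂ * ‖‖u p.1 p.2‖ * θ p.1 p.2‖ + |κ| * C₃ * ‖uncurry θ p‖)
    (((h.integrable_uncurry.norm.const_mul C₁).add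
      (h.integrable_norm_velocity_mul.norm.const_mul C₂)).add
      (h.integrable_uncurry.norm.const_mul (|κ| * C₃))) hm ?_
  filter_upwards [IsWeakScalarTransportForcedOn.ae_fst_mem_Ioo (d := d) T] with p hp
  have hp' : p.1 ∈ Icc 0 T := Ioo_subset_Icc_self hp
  simp only [uncurry, Real.norm_eq_abs, abs_mul, abs_norm]
  have h1 : |Φ₁ p.1 p.2| ≤ C₁ := by
    simpa [Real.norm_eq_abs] using hC₁ p.1 hp' p.2
  have h2 : |⟪u p.1 p.2, Φ₂ p.1 p.2⟫_ℝ| ≤ ‖u p.1 p.2‖ * C₂ :=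
    (abs_real_inner_le_norm _ _).trans (mul_le_mul_of_nonneg_left (hC₂ p.1 hp' p.2) (norm_nonneg _))
  have h3 : |κ * Φ₃ p.1 p.2| ≤ |κ| * C₃ := by
    rw [abs_mul]
    exact mul_le_mul_of_nonneg_left (by simpa [Real.norm_eq_abs] using hC₃ p.1 hp' p.2) (abs_nonneg _)
  have hθ0 : 0 ≤ |θ p.1 p.2| := abs_nonneg _
  calc |θ p.1 p.2| * |Φ₁ p.1 p.2 + ⟪u p.1 p.2, Φ₂ p.1 p.2⟫_ℝ + κ * Φ₃ p.1 p.2|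
      ≤ |θ p.1 p.2| * (C₁ + ‖u p.1 p.2‖ * C₂ + |κ| * C₃) := by
        refine mul_le_mul_of_nonneg_left ((abs_add_le _ _).trans (add_le_add ((abs_add_le _ _).trans
          (add_le_add h1 h2)) h3)) hθ0
    _ = C₁ * |θ p.1 p.2| + C₂ * (‖u p.1 p.2‖ * |θ p.1 p.2|) + |κ| * C₃ * |θ p.1 p.2| := by ring

/-! ## The weak identity in product-measure form -/

/-- **Integrability of the weak integrand** `θ (∂ₜψ + u·∇ψ + κ ∑ᵢ aᵢ ∂ᵢ∂ᵢψ)` on `(0,T) × T^d`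
for a weak solution and a space–time test function. [cite: DiPernaLions1989, §II.1 (12)–(14)] -/
theorem integrable_weakIntegrand (h : IsWeakScalarTransportDiagForcedOn T a κ u s θ₀ θ)
    (hψ : FunctionSpaces.Torus.IsSpaceTimeTest T ψ) :
    Integrable (fun p : ℝ × UnitAddTorus d => θ p.1 p.2 *
      (FunctionSpaces.Torus.timeDeriv ψ p.1 p.2 + ⟪u p.1 p.2, FunctionSpaces.Torus.gradient (ψ p.1) p.2⟫_ℝ +
        κ * ∑ i, a i * FunctionSpaces.Torus.partialDeriv i
          (FunctionSpaces.Torus.partialDeriv i (ψ p.1)) p.2))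
      (((volume : Measure ℝ).restrict (Ioo 0 T)).prod volume) :=
  h.integrable_weakIntegrand_of_continuous (Φ₂ := fun t => FunctionSpaces.Torus.gradient (ψ t))
    (Φ₃ := fun t x => ∑ i, a i * FunctionSpaces.Torus.partialDeriv i
      (FunctionSpaces.Torus.partialDeriv i (ψ t)) x)
    hψ.continuous_uncurry_timeDeriv hψ.continuous_uncurry_gradient (continuous_uncurry_diagOp_test hψ a)

/-- Integrability of the source term `s ψ` on `(0,T) × T^d` for a space–time test function `ψ`.
[cite: DiPernaLions1989, §II.1 (12)–(14)] -/
theorem integrable_source_mul_test (h : IsWeakScalarTransportDiagForcedOn T a κ u s θ₀ θ)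
    (hψ : FunctionSpaces.Torus.IsSpaceTimeTest T ψ) :
    Integrable (fun p : ℝ × UnitAddTorus d => s p.1 p.2 * ψ p.1 p.2)
      (((volume : Measure ℝ).restrict (Ioo 0 T)).prod volume) :=
  h.integrable_source_mul_of_continuous
    (FunctionSpaces.Torus.continuous_uncurry_of_continuous_stLift hψ.1.continuous)

/-- The weak identity in product-measure form:
`∫_{(0,T)×T^d} θ (∂ₜψ + u·∇ψ + κ ∑ᵢ aᵢ ∂ᵢ∂ᵢψ) + ∫_{(0,T)×T^d} s ψ + ∫ θ₀ ψ(0) = 0`. [cite: DiPernaLions1989, §II.1 (12)–(14)] -/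
theorem integral_prod_weak_eq (h : IsWeakScalarTransportDiagForcedOn T a κ u s θ₀ θ)
    (hψ : FunctionSpaces.Torus.IsSpaceTimeTest T ψ) :
    (∫ p : ℝ × UnitAddTorus d, θ p.1 p.2 *
      (FunctionSpaces.Torus.timeDeriv ψ p.1 p.2 + ⟪u p.1 p.2, FunctionSpaces.Torus.gradient (ψ p.1) p.2⟫_ℝ +
        κ * ∑ i, a i * FunctionSpaces.Torus.partialDeriv i
          (FunctionSpaces.Torus.partialDeriv i (ψ p.1)) p.2)
      ∂(((volume : Measure ℝ).restrict (Ioo 0 T)).prod volume)) +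
      (∫ p : ℝ × UnitAddTorus d, s p.1 p.2 * ψ p.1 p.2
        ∂(((volume : Measure ℝ).restrict (Ioo 0 T)).prod volume)) +
      ∫ x, θ₀ x * ψ 0 x = 0 := by
  rw [integral_prod _ (h.integrable_weakIntegrand hψ), integral_prod _ (h.integrable_source_mul_test hψ)]
  exact h.weak_eq ψ hψ

end IsWeakScalarTransportDiagForcedOn

end Torus

end Literature.Analysis.FluidPDE

end
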